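import Mathlib.Algebra.MvPolynomial.PDeriv
import Mathlib.RingTheory.MvPolynomial.Basic
import Mathlib.Algebra.CharP.Two
import Mathlib.RingTheory.Derivation.Basic
import Mathlib.RingTheory.Ideal.Operations
import Mathlib.RingTheory.Ideal.Prime
import Mathlib.Algebra.CharP.Lemmas
import Mathlib.Algebra.BigOperators.Ring.Finset
import HarnessLib

/-!
# «Low order is absorbing» at `p = 2` — the derivation core (chain W4.1, crux `Steer`, §σ2.17/§σ2.19)

OURS (campaign res-hironaka, rung L, slot W4.1; helper for crux `Steer` stmt-ResolutionOfSingularities-16345,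
σ-residual regime cut of res-L0-w41-strat-2 / res-L0-w41-tri-2: one-step lemma `lowOrder_step_two`,
`L/res-L0-w41-tri-2/s17/R2TwoSigma-s17-tri2.delta.lean`). Pure commutative algebra in characteristic `2`;
NOT a statement of any manuscript; nothing here is attributed to [claim: Hironaka2017, status: under-review].
AI-written; weaker than expert review.

THE ARGUMENT (uniform in the height of the centre and in the residue field of the new point — no case
analysis, no rationality of the direction).  After one local blowing up of a regular local `R` along a
regular centre `P = (c₁, …, c_h)` in the `c₁`-chart, the cleaned radicand is `F/c₁² = Q(c₂/c₁, …, c_h/c₁)`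
for the inhomogeneous quadratic `Q(Z) = Σ q_{jl} Z_j Z_l + Σ ℓ_j Z_j + q₀` over `R`, read in the chart
modulo the exceptional divisor: `R[P/c₁]/(c₁) ≅ (R/P)[Z₂, …, Z_h]`.  If the NEW stage is high-order,
`U² Q − B² ∈ 𝔫³` in `(R/P)[Z]` for the prime `𝔫` of the new closed point and a unit `U ∉ 𝔫`.  Apply
the partial derivatives: in characteristic `2` derivations kill squares, so
`∂_a ∂_b (U² Q − B²) = U² (q_{ab} + q_{ba})` lies in `𝔫`, whence every POLAR coefficient
`q_{ab} + q_{ba}` (`a ≠ b`) and then every linear coefficient `ℓ_b` reduces into `𝔫 ∩ (R/P) = 𝔪/P`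
(`polar_mem_of_sq_congr`).  Back at the OLD stage this says the polar form of `in₂ F` vanishes, i.e.
`F` is a square modulo `𝔪³` (`exists_sq_congr_of_polar_mem`, residue field perfect) — the old stage
was high-order.  Contrapositive: low order is absorbing.

* §1 `Derivation`: `map_sq_eq_zero` (char 2), `map_mem_pow_of_mem_pow_succ` (`D(I^{k+1}) ⊆ I^k`),
  `second_order_test` / `first_order_test` (`U² Q − B² ∈ I³`, `U ∉ I` prime ⇒ `D₁ D₂ Q, D Q ∈ I`).
* §2 `MvPolynomial`: `pderiv_quadratic`, `pderiv_pderiv_quadratic`, **`polar_mem_of_sq_congr`**.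
* §3 the old stage: **`exists_sq_congr_of_polar_mem`**.

The chart plumbing (`R[P/c₁]/(c₁) ≅ (R/P)[Z]`, tree `blowupAlgebraQuotEquiv`) that turns these into
`lowOrder_step_two` is the companion file. [cite: Matsumura1987, §25–§26 (derivations)] [folklore]
-/

noncomputable section

-- `Summit.<S>.<S>.…` duplicates the summit name by design (single-problem summit).
set_option linter.dupNamespace false

open MvPolynomial
open scoped BigOperators

namespace Summit.ResolutionOfSingularities.ResolutionOfSingularities.Theorems.SwitchingDichotomy.LowOrderAbsorbing

/-! ## §1 Derivations in characteristic `2` -/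

section Deriv

variable {S A : Type*} [CommRing S] [CommRing A] [Algebra S A]

/-- In characteristic `2` every derivation kills squares. [folklore] -/
theorem map_sq_eq_zero [CharP A 2] (D : Derivation S A A) (a : A) : D (a ^ 2) = 0 := by
  have h2 : (2 : A) = 0 := by
    have := CharP.cast_eq_zero A 2
    simpa using this
  rw [pow_two, D.leibniz, smul_eq_mul, ← two_mul, h2, zero_mul]

/-- A derivation maps `I ^ (k + 1)` into `I ^ k` (Leibniz). [folklore] -/
theorem map_mem_pow_of_mem_pow_succ (D : Derivation S A A) (I : Ideal A) :
    ∀ (k : ℕ) {a : A}, a ∈ I ^ (k + 1) → D a ∈ I ^ k := by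
  intro k
  induction k with
  | zero => intro a _; simp
  | succ k ih =>
    intro a ha
    rw [pow_succ] at ha
    refine Submodule.mul_induction_on ha ?_ ?_
    · intro m hm n hn
      rw [D.leibniz, smul_eq_mul, smul_eq_mul]
      refine Ideal.add_mem _ (Ideal.mul_mem_right _ _ hm) ?_
      have : n * D m ∈ I ^ (k + 1) := by
        rw [pow_succ']
        exact Ideal.mul_mem_mul hn (ih hm)
      exact this
    · intro x y hx hy
      rw [map_add]
      exact Ideal.add_mem _ hx hy

/-- **Second-order test**: if `U² Q − B² ∈ I³` with `I` prime and `U ∉ I`, then `D₁ (D₂ Q) ∈ I` for all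
derivations `D₁, D₂` (characteristic `2`: derivations kill `U²` and `B²`). [folklore] -/
theorem second_order_test [CharP A 2] (I : Ideal A) [hI : I.IsPrime] (D₁ D₂ : Derivation S A A)
    {U Q B : A} (hU : U ∉ I) (h : U ^ 2 * Q - B ^ 2 ∈ I ^ 3) : D₁ (D₂ Q) ∈ I := by
  have h2 : D₂ (U ^ 2 * Q - B ^ 2) = U ^ 2 * D₂ Q := by
    rw [map_sub, D₂.leibniz, map_sq_eq_zero, map_sq_eq_zero, smul_zero, add_zero, sub_zero, smul_eq_mul]
  have h1 : D₁ (D₂ (U ^ 2 * Q - B ^ 2)) = U ^ 2 * D₁ (D₂ Q) := by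
    rw [h2, D₁.leibniz, map_sq_eq_zero, smul_zero, add_zero, smul_eq_mul]
  have hmem : D₁ (D₂ (U ^ 2 * Q - B ^ 2)) ∈ I ^ 1 :=
    map_mem_pow_of_mem_pow_succ D₁ I 1 (map_mem_pow_of_mem_pow_succ D₂ I 2 h)
  rw [pow_one, h1] at hmem
  rcases hI.mem_or_mem hmem with hU2 | hQ
  · exact absurd (hI.mem_of_pow_mem 2 hU2) hU
  · exact hQ

/-- **First-order test**: if `U² Q − B² ∈ I³` with `I` prime and `U ∉ I`, then `D Q ∈ I`. [folklore] -/
theorem first_order_test [CharP A 2] (I : Ideal A) [hI : I.IsPrime] (D : Derivation S A A)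
    {U Q B : A} (hU : U ∉ I) (h : U ^ 2 * Q - B ^ 2 ∈ I ^ 3) : D Q ∈ I := by
  have h2 : D (U ^ 2 * Q - B ^ 2) = U ^ 2 * D Q := by
    rw [map_sub, D.leibniz, map_sq_eq_zero, map_sq_eq_zero, smul_zero, add_zero, sub_zero, smul_eq_mul]
  have hmem : D (U ^ 2 * Q - B ^ 2) ∈ I ^ 2 := map_mem_pow_of_mem_pow_succ D I 2 h
  rw [h2] at hmem
  have hmem' : U ^ 2 * D Q ∈ I := Ideal.pow_le_self two_ne_zero hmem
  rcases hI.mem_or_mem hmem' with hU2 | hQ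
  · exact absurd (hI.mem_of_pow_mem 2 hU2) hU
  · exact hQ

end Deriv

/-! ## §2 The inhomogeneous quadratic in the exceptional chart -/

section Quadratic

variable {S : Type*} [CommRing S] {σ : Type*} [Fintype σ] [DecidableEq σ]

omit [Fintype σ] in
/-- `∂_b (r Z_j) = r [j = b]`. [folklore] -/
theorem pderiv_C_mul_X (r : S) (b j : σ) :
    pderiv b (C r * X j : MvPolynomial σ S) = if j = b then C r else 0 := by
  rw [Derivation.leibniz, pderiv_C, smul_zero, add_zero, smul_eq_mul]
  split_ifs with h
  · subst h; rw [pderiv_X_self, mul_one]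
  · rw [pderiv_X_of_ne h, mul_zero]

omit [Fintype σ] in
/-- `∂_b (r Z_j Z_l) = [l = b] r Z_j + [j = b] r Z_l`. [folklore] -/
theorem pderiv_C_mul_X_mul_X (r : S) (b j l : σ) :
    pderiv b (C r * X j * X l : MvPolynomial σ S) =
      (if l = b then C r * X j else 0) + (if j = b then C r * X l else 0) := by
  rw [Derivation.leibniz, pderiv_C_mul_X, smul_eq_mul, smul_eq_mul]
  by_cases hl : l = b
  · rw [if_pos hl, hl, pderiv_X_self]
    by_cases hj : j = b
    · rw [if_pos hj, if_pos hj]; ring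
    · rw [if_neg hj, if_neg hj]; ring
  · rw [if_neg hl, pderiv_X_of_ne hl]
    by_cases hj : j = b
    · rw [if_pos hj, if_pos hj]; ring
    · rw [if_neg hj, if_neg hj]; ring

/-- `∂_b (Σ q_{jl} Z_j Z_l + Σ ℓ_j Z_j + q₀) = Σ_j (q_{bj} + q_{jb}) Z_j + ℓ_b` (any characteristic).
[folklore] -/
theorem pderiv_quadratic (q : σ → σ → S) (ℓ : σ → S) (q₀ : S) (b : σ) :
    pderiv b (∑ j, ∑ l, C (q j l) * X j * X l + ∑ j, C (ℓ j) * X j + C q₀ : MvPolynomial σ S) =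
      ∑ j, C (q b j + q j b) * X j + C (ℓ b) := by
  rw [map_add (pderiv b), map_add (pderiv b), pderiv_C, add_zero]
  simp only [map_sum (pderiv b), pderiv_C_mul_X_mul_X, pderiv_C_mul_X]
  rw [Finset.sum_ite_eq' Finset.univ b, if_pos (Finset.mem_univ b)]
  congr 1
  have hj : ∀ j : σ, (∑ l, ((if l = b then C (q j l) * X j else 0) +
      (if j = b then C (q j l) * X l else (0 : MvPolynomial σ S)))) =
      C (q j b) * X j + (if j = b then ∑ l, C (q j l) * X l else 0) := by
    intro j
    rw [Finset.sum_add_distrib, Finset.sum_ite_eq' Finset.univ b, if_pos (Finset.mem_univ b)]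
    congr 1
    split_ifs
    · rfl
    · simp
  rw [Finset.sum_congr rfl (fun j _ => hj j), Finset.sum_add_distrib,
    Finset.sum_ite_eq' Finset.univ b, if_pos (Finset.mem_univ b), ← Finset.sum_add_distrib]
  apply Finset.sum_congr rfl
  intro j _
  rw [map_add]
  ring

/-- `∂_a ∂_b (Σ q_{jl} Z_j Z_l + Σ ℓ_j Z_j + q₀) = q_{ba} + q_{ab}`. [folklore] -/
theorem pderiv_pderiv_quadratic (q : σ → σ → S) (ℓ : σ → S) (q₀ : S) (a b : σ) :
    pderiv a (pderiv b
      (∑ j, ∑ l, C (q j l) * X j * X l + ∑ j, C (ℓ j) * X j + C q₀ : MvPolynomial σ S)) =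
      C (q b a + q a b) := by
  rw [pderiv_quadratic, map_add (pderiv a), pderiv_C, add_zero]
  simp only [map_sum (pderiv a), pderiv_C_mul_X]
  rw [Finset.sum_ite_eq' Finset.univ a, if_pos (Finset.mem_univ a)]

/-- **Polar coefficients at the new stage.** In characteristic `2`: if `U² Q − B² ∈ 𝔫³` for the
inhomogeneous quadratic `Q = Σ q_{jl} Z_j Z_l + Σ ℓ_j Z_j + q₀` over `S`, a prime `𝔫` of `S[Z]` and
`U ∉ 𝔫`, then all polar coefficients `q_{ab} + q_{ba}` (`a ≠ b`) and all linear coefficients `ℓ_b`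
have their constants `C _` in `𝔫`. [folklore] -/
theorem polar_mem_of_sq_congr [CharP S 2] (𝔫 : Ideal (MvPolynomial σ S)) [𝔫.IsPrime]
    (q : σ → σ → S) (ℓ : σ → S) (q₀ : S) {U B : MvPolynomial σ S} (hU : U ∉ 𝔫)
    (h : U ^ 2 * (∑ j, ∑ l, C (q j l) * X j * X l + ∑ j, C (ℓ j) * X j + C q₀) - B ^ 2 ∈ 𝔫 ^ 3) :
    (∀ a b, a ≠ b → (C (q a b + q b a) : MvPolynomial σ S) ∈ 𝔫) ∧
      ∀ b, (C (ℓ b) : MvPolynomial σ S) ∈ 𝔫 := by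
  have hpolar : ∀ a b, (C (q a b + q b a) : MvPolynomial σ S) ∈ 𝔫 := by
    intro a b
    have := second_order_test 𝔫 (pderiv a) (pderiv b) hU h
    rwa [pderiv_pderiv_quadratic q ℓ q₀ a b, add_comm] at this
  refine ⟨fun a b _ => hpolar a b, fun b => ?_⟩
  have h1 := first_order_test 𝔫 (pderiv b) hU h
  rw [pderiv_quadratic] at h1
  have hsum : (∑ j, C (q b j + q j b) * X j : MvPolynomial σ S) ∈ 𝔫 :=
    Submodule.sum_mem _ fun j _ => Ideal.mul_mem_right _ _ (hpolar b j)
  have := Ideal.sub_mem _ h1 hsum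
  rwa [add_sub_cancel_left] at this

end Quadratic

/-! ## §3 The old stage: vanishing polar coefficients make `F` a square modulo `𝔪³` -/

section OldStage

variable {R : Type*} [CommRing R]

/-- **Vanishing polar form ⇒ square modulo `𝔪³`.** In characteristic `2`, with every residue a square
(`∀ a, ∃ b, a − b² ∈ M`): if `F = Σ_{a,b} q_{ab} y_a y_b` with all `y_a ∈ M` and all polar coefficients
`q_{ab} + q_{ba} ∈ M` (`a ≠ b`), then `F − b² ∈ M³` for some `b` (namely `b = Σ c_a y_a`, `c_a² ≡ q_{aa}`).
[folklore] -/
theorem exists_sq_congr_of_polar_mem [CharP R 2] (M : Ideal R) (hperf : ∀ a : R, ∃ b : R, a - b ^ 2 ∈ M)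
    {h : ℕ} (y : Fin h → R) (hy : ∀ a, y a ∈ M) (q : Fin h → Fin h → R)
    (hpolar : ∀ a b, a ≠ b → q a b + q b a ∈ M) :
    ∃ b : R, (∑ a, ∑ b, q a b * y a * y b) - b ^ 2 ∈ M ^ 3 := by
  classical
  choose c hc using hperf
  refine ⟨∑ a, c (q a a) * y a, ?_⟩
  have hsq : (∑ a, c (q a a) * y a) ^ 2 = ∑ a, c (q a a) ^ 2 * y a ^ 2 := by
    rw [sum_pow_char 2]
    simp only [mul_pow]
  rw [hsq]
  -- split the double sum into diagonal and off-diagonal parts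
  have hsplit : (∑ a, ∑ b, q a b * y a * y b) =
      ∑ a, q a a * y a * y a + ∑ a, ∑ b, if a = b then 0 else q a b * y a * y b := by
    have hab : ∀ a b : Fin h, q a b * y a * y b =
        (if a = b then q a b * y a * y b else 0) + (if a = b then 0 else q a b * y a * y b) := by
      intro a b
      split_ifs <;> simp
    have h1 : (∑ a, ∑ b, q a b * y a * y b) =
        ∑ a, ((∑ b, if a = b then q a b * y a * y b else 0) +
          ∑ b, if a = b then 0 else q a b * y a * y b) := by
      apply Finset.sum_congr rfl
      intro a _
      rw [← Finset.sum_add_distrib]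
      exact Finset.sum_congr rfl fun b _ => hab a b
    rw [h1, Finset.sum_add_distrib]
    congr 1
    apply Finset.sum_congr rfl
    intro a _
    rw [Finset.sum_ite_eq Finset.univ a, if_pos (Finset.mem_univ a)]
  rw [hsplit]
  have hdiag : (∑ a, q a a * y a * y a) - ∑ a, c (q a a) ^ 2 * y a ^ 2 ∈ M ^ 3 := by
    rw [← Finset.sum_sub_distrib]
    refine Submodule.sum_mem _ fun a _ => ?_
    have : q a a * y a * y a - c (q a a) ^ 2 * y a ^ 2 = (q a a - c (q a a) ^ 2) * (y a * y a) := by ring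
    rw [this, show M ^ 3 = M * (M * M) from by rw [pow_succ, pow_two, mul_comm]]
    exact Ideal.mul_mem_mul (hc _) (Ideal.mul_mem_mul (hy a) (hy a))
  -- the off-diagonal part: pair `(a, b)` with `(b, a)`
  have hoff : (∑ a, ∑ b, if a = b then (0 : R) else q a b * y a * y b) ∈ M ^ 3 := by
    have hlt : (∑ a, ∑ b, if a = b then (0 : R) else q a b * y a * y b) =
        ∑ a, ∑ b, if a < b then (q a b + q b a) * y a * y b else 0 := by
      have hL : (∑ a : Fin h, ∑ b : Fin h, if a = b then (0 : R) else q a b * y a * y b) =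
          (∑ a : Fin h, ∑ b : Fin h, if a < b then q a b * y a * y b else 0) +
          ∑ a : Fin h, ∑ b : Fin h, if b < a then q a b * y a * y b else 0 := by
        rw [← Finset.sum_add_distrib]
        apply Finset.sum_congr rfl; intro a _
        rw [← Finset.sum_add_distrib]
        apply Finset.sum_congr rfl; intro b _
        rcases lt_trichotomy a b with hab | hab | hab
        · rw [if_neg (ne_of_lt hab), if_pos hab, if_neg (not_lt.2 hab.le), add_zero]
        · subst hab; simp
        · rw [if_neg (ne_of_gt hab), if_neg (not_lt.2 hab.le), if_pos hab, zero_add]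
      have hR : (∑ a : Fin h, ∑ b : Fin h, if b < a then q a b * y a * y b else (0 : R)) =
          ∑ a : Fin h, ∑ b : Fin h, if a < b then q b a * y a * y b else 0 := by
        rw [Finset.sum_comm]
        apply Finset.sum_congr rfl; intro a _
        apply Finset.sum_congr rfl; intro b _
        split_ifs <;> ring
      rw [hL, hR, ← Finset.sum_add_distrib]
      apply Finset.sum_congr rfl; intro a _
      rw [← Finset.sum_add_distrib]
      apply Finset.sum_congr rfl; intro b _
      split_ifs <;> ring
    rw [hlt]
    refine Submodule.sum_mem _ fun a _ => Submodule.sum_mem _ fun b _ => ?_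
    split_ifs with hab
    · rw [show M ^ 3 = M * M * M from by rw [pow_succ, pow_two]]
      exact Ideal.mul_mem_mul (Ideal.mul_mem_mul (hpolar a b (ne_of_lt hab)) (hy a)) (hy b)
    · exact Ideal.zero_mem _
  have : (∑ a, q a a * y a * y a + ∑ a, ∑ b, if a = b then (0 : R) else q a b * y a * y b) -
      ∑ a, c (q a a) ^ 2 * y a ^ 2 =
      ((∑ a, q a a * y a * y a) - ∑ a, c (q a a) ^ 2 * y a ^ 2) +
        ∑ a, ∑ b, if a = b then (0 : R) else q a b * y a * y b := by ring
  rw [this]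
  exact Ideal.add_mem _ hdiag hoff

end OldStage

end Summit.ResolutionOfSingularities.ResolutionOfSingularities.Theorems.SwitchingDichotomy.LowOrderAbsorbing

end
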